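import Literature.Computability.QuantumComplexity.LightConeMachineRun
import HarnessLib

/-!
# The light-cone simulator as an `FP` machine, V: the whole machine and its correctness

Last machine file of the discharge of `Literature.Barriers.QuantumAdvantage.markovShi2008_cor15_anyOrder`
(Markov–Shi 2008, Cor. 1.5, decision form). The pieces of `LightConeMachineCone/Gate/Run.lean`
are composed into one string function of the input `x` of a Clifford+`T` family `F`:

  `x ↦ d` (description of the `|x|`-th circuit, `QCircuitFamily.descFn`) `↦` reversed gate codes
  `↦ ⟨S, CC⟩` (cone of wire `0`) `↦ st₀` (initial sparse state of the cone on `|x 0^m⟩`)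
  `↦ st_T` (the kept gates applied) `↦ ⟨A, B⟩` (read-out) `↦ [0 < 10A + 14B − 5·2ʰ]`,

with a yardstick `Y = 1^{Q(|⟨x, d⟩|)}` (`Q` a polynomial parameter) threaded through the clipped
loops.

* `mainF F Q`, **`decideF F Q b₀`** (the answer `b₀` is hard-wired on the empty input);
* **`decideF_mem_FP`**: in `FP` for a uniform family (the description function is then in `FP`,
  `QCircuitFamily.descFn_mem_FP_of_isUniform`, and everything else is brick algebra);
* **`mainF_spec`**: for an oracle-free family and a nonempty input, if
  `2^{|S|} (4N + 42|CC| + 128) ≤ Q(|⟨x, d⟩|)` then `mainF F Q x = [0 < decisionW F x]` — so that,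
  with `LightCone.decisionW_pos_iff` (`LightConeDecision.lean`), the machine decides every language
  the family decides with a `(2/3, 1/3)` gap, in polynomial time as soon as `2^{|S|}` is
  polynomially bounded (logarithmic cone width: Markov–Shi's hypothesis).

## References

* I. L. Markov, Y. Shi, *Simulating quantum computation by contracting tensor networks*, SIAM J.
  Comput. 38 (2008) 963–981, §1 Cor. 1.5.
* S. Arora, B. Barak, *Computational Complexity: A Modern Approach*, CUP 2009, §1.3, §6.2.
* M. A. Nielsen, I. L. Chuang, *Quantum Computation and Quantum Information*, CUP 2010, Box 4.1.
-/

noncomputable section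

namespace Literature.Computability.QuantumComplexity

open _root_.Computability Polynomial Complexity Complexity.Brick Complexity.Plumb Cryptography

namespace LightCone

attribute [-simp] Brick.nthF_zero Brick.sndPow_zero

section Machine

variable (F : QCircuitFamily cliffordT) (Q : Polynomial ℕ)

/-- The description `d = ⟨bin n, ⟨1ᵐ, codes⟩⟩` of the `|x|`-th circuit. [folklore] -/
def dF : List Bool → List Bool := F.descFn
/-- The reversed gate codes. [folklore] -/
def revEF : List Bool → List Bool := revF ∘ sndF ∘ dF F
/-- The cone of wire `0`: `⟨sEnc S, ccEnc CC⟩`. [folklore] -/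
def coneF : List Bool → List Bool := conePassF ∘ pr (fun _ => []) (revEF F)
/-- The yardstick `1^{Q(|⟨x, d⟩|)}`. [folklore] -/
def yardF : List Bool → List Bool := polyFn Q ∘ pr id (dF F)
/-- The base label `x 0ᵐ`. [folklore] -/
def w0F : List Bool → List Bool := OracleCompose.concatFn ∘ pr id (Kannan.zerosFn ∘ fstF ∘ sndF ∘ dF F)
/-- The environment `⟨Y, x 0ᵐ⟩`. [folklore] -/
def envF : List Bool → List Bool := pr (yardF F Q) (w0F F)
/-- The initial sparse state of the cone. [folklore] -/
def st0F : List Bool → List Bool := initPassF ∘ pr (envF F Q) (fstF ∘ coneF F)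
/-- The final sparse state. [folklore] -/
def stTF : List Bool → List Bool := gatePassF ∘ pr (pr (envF F Q) (st0F F Q)) (sndF ∘ coneF F)
/-- The read-out sums `⟨dpEnc A, dpEnc B⟩`. [folklore] -/
def abF : List Bool → List Bool := sumPassF ∘ pr (yardF F Q) (stTF F Q)
/-- The Hadamard count of the kept gates, unary. [folklore] -/
def uhF : List Bool → List Bool := hCountF ∘ coneF F

/-- **The simulator**: `x ↦ [0 < 10A + 14B − 5·2ʰ]`. [folklore] -/
def mainF : List Bool → List Bool := verdictF ∘ pr (abF F Q) (uhF F)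

/-- **The decider**: the hard-wired answer `b₀` on the empty input, the simulator otherwise.
[folklore] -/
def decideF (b₀ : Bool) : List Bool → List Bool := iteFn isNilFn (fun _ => [b₀]) (mainF F Q)

variable {F}

/-- `dF ∈ FP` for a uniform family. [cite: AroraBarak2009, §6.2 (P-uniform families)] -/
theorem dF_mem_FP (hU : F.IsUniform) : dF F ∈ FP := QCircuitFamily.descFn_mem_FP_of_isUniform hU
/-- `coneF ∈ FP`. [folklore] -/
theorem coneF_mem_FP (hU : F.IsUniform) : coneF F ∈ FP :=
  comp_mem_FP conePassF_mem_FP (fanoutFn_mem_FP (const_mem_FP _)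
    (comp_mem_FP revF_mem_FP (comp_mem_FP sndF_mem_FP (dF_mem_FP hU))))
/-- `yardF ∈ FP`. [folklore] -/
theorem yardF_mem_FP (hU : F.IsUniform) : yardF F Q ∈ FP :=
  comp_mem_FP (polyFn_mem_FP Q) (fanoutFn_mem_FP OracleCompose.id_mem_FP (dF_mem_FP hU))
/-- `w0F ∈ FP`. [folklore] -/
theorem w0F_mem_FP (hU : F.IsUniform) : w0F F ∈ FP :=
  comp_mem_FP OracleCompose.concatFn_mem_FP (fanoutFn_mem_FP OracleCompose.id_mem_FP
    (comp_mem_FP Kannan.zerosFn_mem_FP (comp_mem_FP fstF_mem_FP (comp_mem_FP sndF_mem_FP (dF_mem_FP hU)))))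
/-- `envF ∈ FP`. [folklore] -/
theorem envF_mem_FP (hU : F.IsUniform) : envF F Q ∈ FP := fanoutFn_mem_FP (yardF_mem_FP Q hU) (w0F_mem_FP hU)
/-- `st0F ∈ FP`. [folklore] -/
theorem st0F_mem_FP (hU : F.IsUniform) : st0F F Q ∈ FP :=
  comp_mem_FP initPassF_mem_FP (fanoutFn_mem_FP (envF_mem_FP Q hU) (comp_mem_FP fstF_mem_FP (coneF_mem_FP hU)))
/-- `stTF ∈ FP`. [folklore] -/
theorem stTF_mem_FP (hU : F.IsUniform) : stTF F Q ∈ FP :=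
  comp_mem_FP gatePassF_mem_FP (fanoutFn_mem_FP (fanoutFn_mem_FP (envF_mem_FP Q hU) (st0F_mem_FP Q hU))
    (comp_mem_FP sndF_mem_FP (coneF_mem_FP hU)))
/-- `abF ∈ FP`. [folklore] -/
theorem abF_mem_FP (hU : F.IsUniform) : abF F Q ∈ FP :=
  comp_mem_FP sumPassF_mem_FP (fanoutFn_mem_FP (yardF_mem_FP Q hU) (stTF_mem_FP Q hU))
/-- `uhF ∈ FP`. [folklore] -/
theorem uhF_mem_FP (hU : F.IsUniform) : uhF F ∈ FP := comp_mem_FP hCountF_mem_FP (coneF_mem_FP hU)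
/-- **`mainF ∈ FP`** for a uniform family. [cite: AroraBarak2009, §1.3] -/
theorem mainF_mem_FP (hU : F.IsUniform) : mainF F Q ∈ FP :=
  comp_mem_FP verdictF_mem_FP (fanoutFn_mem_FP (abF_mem_FP Q hU) (uhF_mem_FP hU))
/-- **`decideF ∈ FP`** for a uniform family. [cite: AroraBarak2009, §1.3] -/
theorem decideF_mem_FP (hU : F.IsUniform) (b₀ : Bool) : decideF F Q b₀ ∈ FP :=
  iteFn_mem_FP isNilFn_mem_FP (const_mem_FP _) (mainF_mem_FP Q hU)

/-- The decider on the empty input. [folklore] -/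
theorem decideF_nil (b₀ : Bool) : decideF F Q b₀ [] = [b₀] := by
  rw [decideF, iteFn_apply (c := isNilFn) (b := true) (show isNilFn ([] : List Bool) = [true] from rfl)]; rfl

/-- The decider on a nonempty input is the simulator. [folklore] -/
theorem decideF_of_ne_nil (b₀ : Bool) {x : List Bool} (hx : x ≠ []) : decideF F Q b₀ x = mainF F Q x := by
  rw [decideF, iteFn_apply (c := isNilFn) (b := false) (by simp [isNilFn, hx])]; rfl

end Machine

/-! ### Correctness of the simulator -/

section Spec

variable {F : QCircuitFamily cliffordT} (Q : Polynomial ℕ) (hfree : F.IsOracleFree) (x : List Bool)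
  (hN : 0 < x.length + F.ancillas x.length)

include hfree

/-- The stages of the simulator on `x`: description, cone, yardstick, base label. [folklore] -/
theorem stages_eq :
    dF F x = boolPair (encodeNat x.length) (boolPair (ones (F.ancillas x.length)) (ccEnc (F.circ x.length).gates)) ∧
    coneF F x = pairEnc (coneData F x hN) ∧
    yardF F Q x = ones (Q.eval (boolPair x (F.descFn x)).length) ∧
    w0F F x = List.ofFn (baseLabel F x) := by
  have hd : dF F x = boolPair (encodeNat x.length) (boolPair (ones (F.ancillas x.length)) (ccEnc (F.circ x.length).gates)) :=
    ADH.descFn_eq F x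
  have hrev : revEF F x = encList ((F.circ x.length).gates.map QGate.encode).reverse := by
    rw [revEF, Function.comp_apply, Function.comp_apply, hd]
    exact revF_apply (by rw [sndF_boolPair, sndF_boolPair]; rfl)
  refine ⟨hd, ?_, ?_, ?_⟩
  · rw [coneF, Function.comp_apply, pr_apply, hrev, coneData]
    exact conePassF_spec hN (hfree x.length) (sndF_boolPair _ _)
  · rw [yardF, Function.comp_apply, pr_apply, polyFn_apply]; rfl
  · rw [w0F, Function.comp_apply, pr_apply, baseLabel, ADH.ofFn_padInput]
    simp [hd, ones]

/-- **Correctness of the simulator.** For an oracle-free family and a nonempty register, if the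
yardstick dominates the sizes of the simulation — `2^{|S|} (4N + 42|CC| + 128) ≤ Q(|⟨x, d⟩|)` with
`⟨S, CC⟩` the cone of wire `0` — then `mainF F Q x` is the bit `[0 < decisionW F x]`. [folklore] -/
theorem mainF_spec
    (hQ : 2 ^ (coneData F x hN).1.length * (4 * (x.length + F.ancillas x.length) + 42 * (coneData F x hN).2.length + 128) ≤
      Q.eval (boolPair x (F.descFn x)).length) :
    mainF F Q x = [decide (0 < decisionW F x hN)] := by
  obtain ⟨hd, hcone, hY, hw0⟩ := stages_eq Q hfree x hN
  set S := (coneData F x hN).1 with hS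
  set cc := (coneData F x hN).2 with hcc
  set Y := yardF F Q x with hYdef
  have hspec := coneL_spec (F.circ x.length).gates [⟨0, hN⟩] (hfree x.length) (List.nodup_singleton _)
  have hccfree : ∀ g ∈ cc, g.IsOracleFree := fun g hg =>
    hfree x.length g (mem_of_mem_cone (by rw [hcc, coneData, hspec.1] at hg; exact hg))
  -- sizes
  have hP : 1 ≤ 2 ^ S.length := Nat.one_le_two_pow
  have hSl : S.length < 2 ^ S.length := Nat.lt_two_pow_self
  have hYl : 2 ^ S.length * (4 * (x.length + F.ancillas x.length) + 42 * cc.length + 128) ≤ Y.length := by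
    rw [hY]; simpa [ones] using hQ
  have hfst : fstF (coneF F x) = sEnc S := by rw [hcone, pairEnc, fstF_boolPair]
  have hsnd : sndF (coneF F x) = ccEnc cc := by rw [hcone, pairEnc, sndF_boolPair]
  -- the initial state
  have hst0 : st0F F Q x = stEnc (initState S (baseLabel F x)) := by
    rw [st0F, Function.comp_apply, pr_apply, envF, pr_apply, Function.comp_apply, hfst, hw0]
    refine initPassF_spec Y S (baseLabel F x) ?_
    have : Y.length ≤ (boolPair (boolPair Y (List.ofFn (baseLabel F x))) (sEnc S)).length := by
      simp only [length_boolPair]; omega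
    nlinarith
  -- the final state
  have hstT : stTF F Q x = stEnc (finalState F x hN) := by
    rw [stTF, Function.comp_apply, pr_apply, pr_apply, envF, pr_apply, Function.comp_apply, hsnd, hst0, hw0, finalState,
      ← hS, ← hcc]
    refine gatePassF_spec Y S (baseLabel F x) cc hccfree (by nlinarith) ?_
    have : Y.length ≤ (gpInput Y (baseLabel F x) (stEnc (initState S (baseLabel F x))) (ccEnc cc)).length := by
      simp only [gpInput, length_boolPair]; omega
    nlinarith
  -- the read-out
  have hamp : ∀ p ∈ finalState F x hN, AmpLt (1 + cc.length) p.2 := by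
    rw [finalState, ← hS, ← hcc]; exact ampLt_runGates cc (ampLt_initState S (baseLabel F x))
  have hab : abF F Q x = boolPair (dpEnc (sums (finalState F x hN)).1) (dpEnc (sums (finalState F x hN)).2) := by
    rw [abF, Function.comp_apply, pr_apply, hstT]
    refine sumPassF_spec Y (finalState F x hN) (s := S.length) hamp (by rw [length_finalState]) ?_
    have : Y.length ≤ (boolPair Y (stEnc (finalState F x hN))).length := by simp only [length_boolPair]; omega
    nlinarith
  -- the Hadamard count and the verdict
  have huh : uhF F x = ones (hCount cc) := by
    rw [uhF, Function.comp_apply]; exact hCountF_ccEnc hccfree hsnd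
  rw [mainF, Function.comp_apply, pr_apply, hab, huh, verdictF_apply, ival_dpEnc, ival_dpEnc, decisionW]

end Spec

end LightCone

end Literature.Computability.QuantumComplexity

end
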